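import Mathlib
import Summits.ResolutionOfSingularities.ResolutionOfSingularities.Theses.WildQuotients
import Summits.ResolutionOfSingularities.ResolutionOfSingularities.Theorems.WildQuotientsKiralyLutkebohmertLemmas
import Literature.AlgebraicGeometry.Resolution.RegularLocalRingsFlatDescent

/-!
# `WildQuotients.KiralyLutkebohmert` (stmt-ResolutionOfSingularities-15643) — PROVED

Route `ResolutionOfSingularities/WildQuotients`, support item `KiralyLutkebohmert`:
Király–Lütkebohmert, *Group actions of prime order on local normal rings*, Algebra & Number
Theory 7 (2013) 63–74, Theorem 2, (a) ⇒ (d): for a regular local ring `B` and a ring automorphism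
`σ` of prime order `p`, if the augmentation ideal `(σ b − b : b ∈ B)` is principal then the ring
of invariants `B^σ` is a regular local ring.

Proof as in the paper. `kl_free` is Proposition 5 / Thm. 2 (a)⇒(c): with an augmentation
generator `y` (`I_G = (σ y − y)`), `B = ⊕_{i<p} A·yⁱ` over `A = B^σ`. We run the argument inside
`L = Frac B`: `K = L^{⟨σ⟩}` has `[L : K] = p` (Artin, Mathlib `FixedPoints.finrank_eq_card`), so
`1, y, …, y^{p−1}` is a `K`-basis of `L`; the `K`-linear divided-difference operators
`Φₙ = (σⁿy − y)⁻¹ (σ − 1) Φₙ₋₁` kill `yⁱ` (`i < n`), send `yⁿ ↦ 1` (Lemma 4, via complete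
homogeneous symmetric polynomials) and preserve `B` (change of augmentation generator), which
peels off the coordinates of any `b ∈ B` one by one and shows they lie in `A`. Then `B` is free,
hence faithfully flat over `A`, so `A` is local and Noetherian and `A → B` is a flat local
homomorphism (Mathlib), and regularity descends by Matsumura 23.7 (i)
(`Literature.AlgebraicGeometry.Resolution.IsRegularLocalRing.of_flat_of_isLocalHom`).
No normality/Noetherian hypothesis beyond "regular local" is used, as in the paper (p. 69).
-/

-- single-problem summit: the doubled namespace component `ResolutionOfSingularities` is forced
set_option linter.dupNamespace false

open IsLocalRing

namespace Summit.ResolutionOfSingularities.ResolutionOfSingularities.Theorems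

section Free

/-- **Király–Lütkebohmert, Proposition 5** (with Thm. 2 (a)⇒(b)⇒(c)): let `B` be a local domain,
`σ` a ring automorphism with `σ^p = 1` (`p` prime) and `y` an augmentation generator
(`(σ c − c : c ∈ B) = (σ y − y) ≠ 0`). Then `B` is a free module over the fixed ring `B^σ`
(indeed `B = ⊕_{i<p} B^σ · y^i`). [cite: KiralyLutkebohmert2013, Prop 5 and Thm 2] -/
theorem kl_free {B : Type*} [CommRing B] [IsDomain B] [IsLocalRing B] {p : ℕ} (hp : p.Prime)
    (σ : B ≃+* B) (hσ : σ ^ p = 1) (y : B) (hy : σ y - y ≠ 0)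
    (hI : Ideal.span (Set.range fun c : B => σ c - c) = Ideal.span {σ y - y}) :
    Module.Free ((σ : B →+* B).eqLocus (RingHom.id B)) B := by
  classical
  haveI : Fact p.Prime := ⟨hp⟩
  set A : Subring B := (σ : B →+* B).eqLocus (RingHom.id B) with hA_def
  have memA : ∀ b : B, b ∈ A ↔ σ b = b := fun b => Iff.rfl
  -- the fraction field and the induced automorphism
  let L := FractionRing B
  let ι : B →+* L := algebraMap B L
  have hι : Function.Injective ι := IsFractionRing.injective B L
  let σL : L ≃+* L := IsFractionRing.ringEquivOfRingEquivHom B L σ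
  have hσLpow : ∀ (k : ℕ) (b : B), (σL ^ k) (ι b) = ι ((σ ^ k) b) := by
    intro k b
    have : σL ^ k = IsFractionRing.ringEquivOfRingEquivHom B L (σ ^ k) := (map_pow _ σ k).symm
    rw [this, IsFractionRing.ringEquivOfRingEquivHom_apply,
      IsFractionRing.ringEquivOfRingEquiv_algebraMap]
  have hσL : ∀ b, σL (ι b) = ι (σ b) := fun b => by simpa using hσLpow 1 b
  have hσLp : σL ^ p = 1 := by
    rw [show σL = IsFractionRing.ringEquivOfRingEquivHom B L σ from rfl, ← map_pow, hσ, map_one]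
  have hσL1 : σL ≠ 1 := by
    intro h
    apply hy
    have := hσL y
    rw [h, RingAut.one_apply] at this
    rw [sub_eq_zero]
    exact (hι this).symm
  -- the cyclic group generated by `σL` and its fixed field `K`
  let G : Subgroup (L ≃+* L) := Subgroup.zpowers σL
  have hfin : IsOfFinOrder σL := isOfFinOrder_iff_pow_eq_one.mpr ⟨p, hp.pos, hσLp⟩
  haveI : Fintype G := Fintype.ofEquiv _ (finEquivZPowers hfin)
  have hcard : Fintype.card G = p := by
    rw [Fintype.card_eq_nat_card, Nat.card_zpowers, orderOf_eq_prime hσLp hσL1]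
  haveI : FaithfulSMul G L := ⟨fun {g₁ g₂} h => Subtype.ext (RingEquiv.ext h)⟩
  let K : Subfield L := FixedPoints.subfield G L
  have memK : ∀ l : L, l ∈ K ↔ σL l = l := by
    intro l
    change (∀ g : G, g • l = l) ↔ _
    constructor
    · intro h
      exact h ⟨σL, Subgroup.mem_zpowers σL⟩
    · intro h g
      change (g : L ≃+* L) • l = l
      exact smul_eq_self_of_mem_zpowers g.2 h
  have hfinrank : Module.finrank K L = p := by rw [FixedPoints.finrank_eq_card, hcard]
  -- `y` seen in `L`; its minimal polynomial over `K` has degree `p`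
  let yL : L := ι y
  have hyK : yL ∉ (algebraMap K L).range := by
    rintro ⟨k, hk⟩
    apply hy
    have h1 : σL yL = yL := by rw [← hk]; exact (memK _).mp k.2
    rw [hσL] at h1
    exact sub_eq_zero.mpr (hι h1)
  have hint : IsIntegral K yL := FixedPoints.isIntegral G L yL
  set d := (minpoly K yL).natDegree with hd_def
  have hd : d = p := by
    have hdvd : d ∣ p := hfinrank ▸ minpoly.degree_dvd hint
    rcases (Nat.dvd_prime hp).mp hdvd with h1 | h1
    · exact absurd (minpoly.natDegree_eq_one_iff.mp h1) hyK
    · exact h1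
  -- the `K`-basis of `L` given by the powers of `yL`
  have hli : LinearIndependent K fun i : Fin d => yL ^ (i : ℕ) := linearIndependent_pow yL
  haveI : Nonempty (Fin d) := ⟨⟨0, by rw [hd]; exact hp.pos⟩⟩
  let bK : Module.Basis (Fin d) K L :=
    basisOfLinearIndependentOfCardEqFinrank hli (by rw [Fintype.card_fin, hfinrank, hd])
  have hbK : ∀ i, bK i = yL ^ (i : ℕ) := fun i => by
    simp only [bK, coe_basisOfLinearIndependentOfCardEqFinrank]
  -- the `K`-linear divided-difference operators `Φ n`
  let gσ : G := ⟨σL, Subgroup.mem_zpowers σL⟩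
  let τK : L →ₗ[K] L := (MulSemiringAction.toAlgHom K L gσ).toLinearMap
  have hτK : ∀ l, τK l = σL l := fun l => rfl
  let x : ℕ → L := fun k => ι ((σ ^ k) y - y)
  let Φ : ℕ → (L →ₗ[K] L) := fun n => Nat.rec (motive := fun _ => L →ₗ[K] L) LinearMap.id
      (fun n Φn => (LinearMap.mulLeft K (x (n + 1))⁻¹) ∘ₗ (τK - LinearMap.id) ∘ₗ Φn) n
  have hΦ0 : ∀ l, Φ 0 l = l := fun l => rfl
  have hΦs : ∀ n l, Φ (n + 1) l = (x (n + 1))⁻¹ * ((σL : L →+* L) (Φ n l) - Φ n l) :=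
    fun n l => rfl
  -- the table of complete homogeneous polynomial values and the node sequence `z k = σL^k yL`
  obtain ⟨H, hH0, hH1, hH2⟩ := kl_cH_exists (R := L)
  let z : ℕ → L := fun k => (σL ^ k) yL
  have hz0 : z 0 = yL := by simp [z]
  have hzs : ∀ k, z (k + 1) = (σL : L →+* L) (z k) := fun k => by
    simp only [z, RingEquiv.coe_toRingHom]; rw [kl_pow_succ_apply]
  have hxz : ∀ k, x k = z k - z 0 := by
    intro k; simp only [x, z, map_sub, hσLpow, pow_zero, RingAut.one_apply, yL]
  -- `x k ≠ 0` for `1 ≤ k < p`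
  have hx0 : ∀ k, 1 ≤ k → k < p → x k ≠ 0 := by
    intro k hk1 hkp hk0
    have h1 : (σ ^ k) y - y = 0 := hι (by rw [map_zero]; exact hk0)
    have h2 : (σ ^ k) y = y := sub_eq_zero.mp h1
    obtain ⟨m, hm⟩ := kl_exists_pow_pow_eq σ hp hσ hk1 hkp
    have h3 : ∀ t : ℕ, ((σ ^ k) ^ t) y = y := by
      intro t
      induction t with
      | zero => simp
      | succ t iht => rw [kl_pow_succ_apply', h2, iht]
    apply hy
    have h4 : σ y = y := by conv_lhs => rw [← hm]; exact h3 m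
    rw [h4, sub_self]
  have hgen : ∀ k, 1 ≤ k → k < p → ∀ b, σ b - b ∈ Ideal.span {(σ ^ k) y - y} := by
    intro k hk1 hkp b
    rw [← kl_span_eq_span_pow_sub σ hp hσ y hy hI hk1 hkp]
    exact Ideal.subset_span ⟨b, rfl⟩
  -- Lemma 4 and integrality, instantiated
  have F2 : ∀ n, n < p →
      (∀ e, Φ n (yL ^ (n + e)) = H z n e) ∧ (∀ i, i < n → Φ n (yL ^ i) = 0) := by
    intro n hn
    have := kl_phi_pow (σL : L →+* L) z hzs x hxz (fun n l => Φ n l) hΦ0 hΦs H hH0 hH1 hH2 n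
      (fun k hk1 hkn => hx0 k hk1 (lt_of_le_of_lt hkn hn))
    rwa [hz0] at this
  have F3 : ∀ n, n < p → ∀ b : B, ∃ c : B, Φ n (ι b) = ι c := fun n hn b =>
    kl_phi_integral σ (σL : L →+* L) hσL (fun k => (σ ^ k) y - y) x (fun k => rfl) hx0 hgen
      (fun n l => Φ n l) hΦ0 hΦs n hn b
  -- an element of `B` fixed by `σL` lies in `A`
  have hKA : ∀ c : B, σL (ι c) = ι c → c ∈ A := fun c hc =>
    (memA c).mpr (hι (by rw [← hσL]; exact hc))
  -- spanning: `B = ∑_{i<d} A y^i`, by descending induction on the top nonzero coordinate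
  let v : Fin d → B := fun i => y ^ (i : ℕ)
  let M : Submodule A B := Submodule.span A (Set.range v)
  have hT : ∀ n, ∀ b : B, (∀ i : Fin d, n ≤ (i : ℕ) → bK.repr (ι b) i = 0) → b ∈ M := by
    intro n
    induction n with
    | zero =>
      intro b hb
      have h1 : ι b = 0 := by
        rw [← bK.sum_repr (ι b)]
        exact Finset.sum_eq_zero fun i _ => by rw [hb i (Nat.zero_le _), zero_smul]
      have hb0 : b = 0 := hι (by rw [h1, map_zero])
      rw [hb0]
      exact M.zero_mem
    | succ n ih =>
      intro b hb
      by_cases hn : n < d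
      · let i₀ : Fin d := ⟨n, hn⟩
        have hnp : n < p := hd ▸ hn
        -- `Φ n (ι b)` is the `n`-th coordinate of `ι b`
        have hΦb : Φ n (ι b) = (bK.repr (ι b) i₀ : L) := by
          conv_lhs => rw [← bK.sum_repr (ι b)]
          rw [map_sum, Finset.sum_eq_single i₀]
          · rw [map_smul, hbK]
            have e1 := (F2 n hnp).1 0
            rw [add_zero, kl_cH_zero_right H hH0 hH1] at e1
            change bK.repr (ι b) i₀ • Φ n (yL ^ n) = _
            rw [e1, Algebra.smul_def, mul_one]
            rfl
          · intro i _ hi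
            have hne : (i : ℕ) ≠ n := fun h => hi (Fin.ext h)
            rcases lt_or_gt_of_ne hne with hlt | hgt
            · rw [map_smul, hbK, (F2 n hnp).2 i hlt, smul_zero]
            · rw [hb i hgt, zero_smul, map_zero]
          · intro h
            exact absurd (Finset.mem_univ i₀) h
        obtain ⟨c, hc⟩ := F3 n hnp b
        have hcK : σL (ι c) = ι c := by
          rw [← hc, hΦb]
          exact (memK _).mp (bK.repr (ι b) i₀).2
        let a : A := ⟨c, hKA c hcK⟩
        have hιa : ι (a • y ^ n) = (bK.repr (ι b) i₀) • bK i₀ := by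
          rw [Subring.smul_def, smul_eq_mul, map_mul, map_pow, hbK, Algebra.smul_def]
          change ι c * ι y ^ n = (bK.repr (ι b) i₀ : L) * yL ^ n
          rw [← hΦb, hc]
        have hb' : b - a • y ^ n ∈ M := by
          apply ih
          intro i hi
          rw [map_sub, hιa, map_sub, map_smul, bK.repr_self, Finsupp.sub_apply,
            Finsupp.smul_apply, Finsupp.single_apply]
          by_cases hii : i₀ = i
          · rw [if_pos hii, smul_eq_mul, mul_one, ← hii, sub_self]
          · rw [if_neg hii, smul_zero, sub_zero]
            have hne : (i : ℕ) ≠ n := fun h => hii (Fin.ext h.symm)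
            exact hb i (lt_of_le_of_ne hi hne.symm)
        have heq : b = (b - a • y ^ n) + a • y ^ n := (sub_add_cancel _ _).symm
        rw [heq]
        exact M.add_mem hb' (M.smul_mem a (Submodule.subset_span ⟨i₀, rfl⟩))
      · exact ih b fun i hi => absurd i.2 (not_lt.mpr (le_trans (not_lt.mp hn) hi))
  have hspan : ⊤ ≤ M := fun b _ => hT d b fun i hi => absurd i.2 (not_lt.mpr hi)
  -- linear independence over `A`
  have hliA : LinearIndependent A v := by
    rw [Fintype.linearIndependent_iff]
    intro g hg i
    let g' : Fin d → K := fun i =>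
      ⟨ι (g i), (memK _).mpr (by rw [hσL, (memA _).mp (g i).2])⟩
    have hsum : ∑ i, g' i • bK i = 0 := by
      have h1 := congrArg ι hg
      rw [map_sum, map_zero] at h1
      rw [← h1]
      refine Finset.sum_congr rfl fun i _ => ?_
      rw [hbK, Algebra.smul_def, Subring.smul_def, smul_eq_mul, map_mul, map_pow]
      rfl
    have h0 := Fintype.linearIndependent_iff.mp bK.linearIndependent g' hsum i
    have h2 : ι (g i) = 0 := congrArg Subtype.val h0
    have h3 : (g i : B) = 0 := hι (by rw [h2, map_zero])
    exact Subtype.ext h3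
  exact Module.Free.of_basis (Module.Basis.mk hliA hspan)

end Free

section Main

/-- **Király–Lütkebohmert, Theorem 2, (a) ⇒ (d)** for a regular local ring `B`: if `σ` is a
ring automorphism of prime order `p` whose augmentation ideal `(σ b − b : b ∈ B)` is principal,
then the fixed ring `B^σ` is a regular local ring. Proof: `B` is free over `A = B^σ`
(`kl_free`), hence faithfully flat, so `A` is local and Noetherian and `A → B` is a flat local
homomorphism; regularity descends (Matsumura 23.7 (i),
`Literature…IsRegularLocalRing.of_flat_of_isLocalHom`). [cite: KiralyLutkebohmert2013, Thm 2] -/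
theorem kl_isRegularLocalRing_eqLocus {p : ℕ} (hp : p.Prime) (B : Type) [CommRing B]
    [IsRegularLocalRing B] (σ : B ≃+* B) (hσ1 : σ ≠ RingEquiv.refl B)
    (hσp : σ ^ p = RingEquiv.refl B)
    (hP : (Ideal.span (Set.range fun b : B => σ b - b)).IsPrincipal) :
    IsRegularLocalRing ((σ : B →+* B).eqLocus (RingHom.id B)) := by
  haveI : IsDomain B := Literature.AlgebraicGeometry.Resolution.isDomain_of_isRegularLocalRing B
  have h0 : Ideal.span (Set.range fun c : B => σ c - c) ≠ ⊥ := by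
    intro h
    apply hσ1
    ext b
    have hb : σ b - b ∈ Ideal.span (Set.range fun c : B => σ c - c) := Ideal.subset_span ⟨b, rfl⟩
    rw [h, Ideal.mem_bot, sub_eq_zero] at hb
    exact hb
  obtain ⟨y, hy, hI⟩ := kl_exists_aug_generator σ hP h0
  set A : Subring B := (σ : B →+* B).eqLocus (RingHom.id B)
  haveI : Module.Free A B := kl_free hp σ hσp y hy hI
  haveI : Module.FaithfullyFlat A B := inferInstance
  haveI : IsLocalRing A := Module.FaithfullyFlat.isLocalRing A B
  haveI : IsNoetherianRing A := by
    rw [isNoetherianRing_iff_ideal_fg]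
    intro I
    exact Ideal.FG.of_FG_map_of_faithfullyFlat (S := B) (IsNoetherian.noetherian _)
  exact Literature.AlgebraicGeometry.Resolution.IsRegularLocalRing.of_flat_of_isLocalHom A B

/-- **`WildQuotients.KiralyLutkebohmert` holds** (stmt-ResolutionOfSingularities-15643):
Király–Lütkebohmert 2013, Theorem 2 (a) ⇒ (d) — for a regular local ring `B` and a ring
automorphism `σ` of prime order `p`, if the augmentation ideal `(σ b − b : b ∈ B)` is principal
then the fixed ring `B^σ = eqLocus σ id` is a regular local ring.
[cite: KiralyLutkebohmert2013, Thm 2] -/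
theorem kiralyLutkebohmert_proof :
    Summit.ResolutionOfSingularities.ResolutionOfSingularities.Theses.WildQuotients.KiralyLutkebohmert := by
  unfold Theses.WildQuotients.KiralyLutkebohmert
  intro p hp B _ _ σ hσ1 hσp hP
  exact kl_isRegularLocalRing_eqLocus hp B σ hσ1 hσp hP

end Main

end Summit.ResolutionOfSingularities.ResolutionOfSingularities.Theorems
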